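import Literature.AlgebraicGeometry.Resolution.LocalBlowup
import Literature.AlgebraicGeometry.Resolution.QuadraticTransforms
import Literature.AlgebraicGeometry.Resolution.BlowupAlgebraPresentation
import Literature.AlgebraicGeometry.Resolution.RegularSystemOfParameters
import Literature.AlgebraicGeometry.Resolution.RsopMonomialIdeals
import Literature.AlgebraicGeometry.Resolution.RegularLocalRingsQuotient
import Mathlib.RingTheory.RegularLocalRing.Polynomial
import Mathlib.RingTheory.DiscreteValuationRing.TFAE
import Mathlib.RingTheory.Ideal.Height
import Mathlib.RingTheory.KrullDimension.Basic
import HarnessLib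

/-!
# The `x_i`-chart `S[𝔪/x_i] ⊆ K` of the blow-up of a regular local subring at its closed point:
# the exceptional fibre is an affine space, and the centre of a dominating DVR

Route-independent commutative algebra about the chart ring `blowupRing S x ⊆ K`
(`QuadraticTransforms.lean`) of a regular local subring `S` of a field `K` and about the centre
`𝔪_O ∩ B` (`subringCentre`, `LocalBlowup.lean`) of a valuation ring `O` on a subring `B ⊆ O`:
* `subringCentre_eq_span_singleton_of_prime`, `exists_eq_mul_of_valuation_lt_one_of_prime` — if
  `O = B_{𝔪_O ∩ B}` is a DVR and `p ∈ B`, `p ≠ 0`, `v(p) > 0`, `pB` prime, then `𝔪_O ∩ B = pB`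
  (a height-one prime containing a prime element is generated by it: Matsumura, proof of Thm. 20.1;
  Mathlib `Ideal.eq_span_singleton_of_height_eq_one`);
* `blowupRing_chartQuotient` — **the exceptional fibre of the chart is an affine space**: for a
  regular system of parameters `x` of `S` and `x_i ≠ 0`, `S[𝔪/x_i]/(x_i) ≅ κ(S)[T_j : j ≠ i]`
  compatibly with `S → S[𝔪/x_i]` (Stacks 0BIQ: the blow-up algebra of an `H₁`-regular
  `(a, a_2, …, a_r)` is `R[y_j]/(a y_j - a_j)`, i.e. `(R/I)[y_j]` modulo `a`; tree
  `blowupAlgebra.comap_eval_span_algebraMap_eq` + quasi-regularity, Matsumura Thm. 17.10); hence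
  `isPrime_span_singleton_blowupRing_of_rsop` (the exceptional prime `(x_i)`) and
  `isRegularRing_blowupRing_quotient_of_rsop`;
* `exists_rsop_apply_eq` (Matsumura Thm. 14.2: `x ∈ 𝔪 ∖ 𝔪²` extends to a regular system of
  parameters) and the single-element forms `blowupRing_chartQuotient_of_not_mem_sq`,
  `isPrime_span_singleton_blowupRing`, `isRegularRing_blowupRing_quotient`,
  `isDomain_blowupRing_quotient`.
The proofs of the first two items are the kernels `centreEqOfPrime` / `chartQuotient` of
`Summits/…/Theorems/RuledResiduesRegularModelRuledExceptional.lean` (route `RuledResidues`) and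
`exists_rsop_apply_eq` that of `Theorems/FrobeniusClosingSteerCore4IsoChartZero.lean`, re-homed so
that route-independent users need not import a Theses cone. No definitions. NOT here: the residue
field of the exceptional prime of a dominating DVR (`exceptionalResidue`), permissibility.
References: Stacks Project Tag 0BIQ (More on Algebra, Lemma 32.2) [StacksProject]; H. Matsumura,
*Commutative Ring Theory* (1986), Thm. 14.2, 17.10, 20.1 (proof) [Matsumura1987]. -/

noncomputable section

open IsLocalRing

namespace Literature.AlgebraicGeometry.Resolution

universe u

/-! ## The centre of a dominating DVR is any nonzero principal prime of positive value -/
section Centre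

variable {K : Type u} [Field K]

/-- **The centre of a DVR on a subring is any nonzero principal prime it contains.** Let `B ⊆ O` be
subrings of a field `K` with `O = B_{𝔪_O ∩ B}` a discrete valuation ring, and `p ∈ B` nonzero of
positive value with `pB` prime. Then the centre `𝔪_O ∩ B` of `O` on `B` is `pB`: it has height
`dim O = 1` and contains the prime element `p` (Matsumura, proof of Thm. 20.1: «if `π ∈ P` then
`(π) ⊂ P`, but `(π)` is a non-zero prime ideal and `ht P = 1`, hence `P = (π)`»; Mathlib
`Ideal.eq_span_singleton_of_height_eq_one`). [cite: Matsumura1987, Thm. 20.1 (proof)] -/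
theorem subringCentre_eq_span_singleton_of_prime (O : ValuationSubring K) [IsDiscreteValuationRing O]
    (B : Subring K) (hBO : B ≤ O.toSubring)
    (hO : O.toSubring = locAtCentre B O) {p : K} (hpB : p ∈ B) (hp0 : p ≠ 0)
    (hvp : O.valuation p < 1) (hprime : (Ideal.span {(⟨p, hpB⟩ : B)}).IsPrime) :
    subringCentre B O hBO = Ideal.span {(⟨p, hpB⟩ : B)} := by
  -- adapted from Summits/…/Theorems/RuledResiduesRegularModelRuledExceptional.lean (`centreEqOfPrime`)
  haveI := isLocalization_locAtCentre hBO
  -- the centre has height `dim O = 1`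
  have hdimloc : ringKrullDim (locAtCentre B O) = 1 := by
    rw [ringKrullDim_eq_of_ringEquiv (RingEquiv.subringCongr hO.symm)]
    exact IsDiscreteValuationRing.ringKrullDim_eq_one O
  have hht : (subringCentre B O hBO).height = 1 := by
    have h := IsLocalization.AtPrime.ringKrullDim_eq_height (subringCentre B O hBO) (locAtCentre B O)
    rw [hdimloc] at h
    exact_mod_cast h.symm
  -- `p` is a prime element of the centre
  have hpB0 : (⟨p, hpB⟩ : B) ≠ 0 := fun h => hp0 (congrArg Subtype.val h)
  have hprimeElt : Prime (⟨p, hpB⟩ : B) := (Ideal.span_singleton_prime hpB0).mp hprime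
  have hpq : (⟨p, hpB⟩ : B) ∈ subringCentre B O hBO := (mem_subringCentre_iff hBO _).mpr hvp
  exact Ideal.eq_span_singleton_of_height_eq_one hht hpq hprimeElt

/-- **Every element of positive value is a multiple of the prime generator of the centre** (membership
form of `subringCentre_eq_span_singleton_of_prime`; verbatim `RuledResiduesRegularModelRuled.centreEqOfPrime`):
`B ⊆ O = B_{𝔪_O ∩ B}` a DVR, `p ∈ B` nonzero of positive value, `pB` prime ⇒ every `z ∈ B` of positive
value is `z = w·p`, `w ∈ B`. [cite: Matsumura1987, Thm. 20.1 (proof)] -/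
theorem exists_eq_mul_of_valuation_lt_one_of_prime (O : ValuationSubring K)
    [IsDiscreteValuationRing O] (B : Subring K) (hBO : B ≤ O.toSubring)
    (hO : O.toSubring = locAtCentre B O) {p : K} (hpB : p ∈ B) (hp0 : p ≠ 0)
    (hvp : O.valuation p < 1) (hprime : (Ideal.span {(⟨p, hpB⟩ : B)}).IsPrime) :
    ∀ z ∈ B, O.valuation z < 1 → ∃ w ∈ B, z = w * p := by
  intro z hz hvz
  have heq := subringCentre_eq_span_singleton_of_prime O B hBO hO hpB hp0 hvp hprime
  have hzq : (⟨z, hz⟩ : B) ∈ subringCentre B O hBO := (mem_subringCentre_iff hBO _).mpr hvz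
  rw [heq, Ideal.mem_span_singleton'] at hzq
  obtain ⟨w, hw⟩ := hzq
  refine ⟨w, w.2, ?_⟩
  have := congrArg Subtype.val hw
  simpa [Subring.coe_mul] using this.symm

end Centre

/-! ## The exceptional fibre of the chart `S[𝔪/x_i]` is an affine space over `κ(S)` -/
section Exceptional

variable {K : Type u} [Field K]

/-- **The exceptional fibre of the chart is an affine space** (Stacks 0BIQ for the regular system of
parameters `x` of the regular local subring `S ⊆ K`; verbatim the statement of
`RuledResiduesRegularModelRuled.chartQuotient`): `S[𝔪/x_i]/(x_i) ≅ κ(S)[T_j : j ≠ i]`, compatibly with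
`S → S[𝔪/x_i]`. The affine blow-up algebra `S[𝔪/x_i] ⊆ S[1/x_i]` (`blowupAlgebra`) maps
isomorphically onto `blowupRing S x_i ⊆ K`; modulo `x_i` its presentation `S[T_j : j ≠ i] → S[𝔪/x_i]`
has kernel `𝔪 · S[T]` (`blowupAlgebra.comap_eval_span_algebraMap_eq`, quasi-regularity of `x`,
Matsumura Thm. 17.10), the kernel of `S[T] → κ(S)[T]`. [cite: StacksProject, Tag 0BIQ] -/
theorem blowupRing_chartQuotient (S : Subring K) [IsRegularLocalRing S] {d : ℕ}
    (hd : (maximalIdeal S).spanFinrank = d) (x : Fin d → S)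
    (hx : Ideal.span (Set.range x) = maximalIdeal S) (i : Fin d) (hxi : x i ≠ 0) :
    ∃ ψ : MvPolynomial {j : Fin d // j ≠ i} (ResidueField S) →+*
        blowupRing S (x i : K) ⧸
          Ideal.span {(⟨(x i : K), le_blowupRing S (x i : K) (x i).2⟩ : blowupRing S (x i : K))},
      Function.Bijective ψ ∧
      ∀ s : S, ψ (MvPolynomial.C (residue S s)) =
        Ideal.Quotient.mk _ ⟨(s : K), le_blowupRing S (x i : K) s.2⟩ := by
  -- adapted from Summits/…/Theorems/RuledResiduesRegularModelRuledExceptional.lean (`chartQuotient`)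
  classical
  have hxm : ∀ j, x j ∈ maximalIdeal S := fun j => hx ▸ Ideal.subset_span ⟨j, rfl⟩
  have hθ : ((x i : S) : K) ≠ 0 := fun h => hxi (Subtype.ext h)
  have hunit : IsUnit (S.subtype (x i)) := isUnit_iff_ne_zero.mpr hθ
  -- `Θ : S[1/x_i] → K` and `g : S[𝔪/x_i] → K`
  let Θ : Localization.Away (x i) →+* K := IsLocalization.Away.lift (x i) hunit
  have hΘalg : ∀ s : S, Θ (algebraMap S (Localization.Away (x i)) s) = (s : K) := fun s =>
    IsLocalization.Away.lift_eq (x i) hunit s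
  have hΘinv : Θ (IsLocalization.Away.invSelf (x i)) = ((x i : S) : K)⁻¹ := by
    apply eq_inv_of_mul_eq_one_left
    rw [← hΘalg (x i), ← map_mul, mul_comm, IsLocalization.Away.mul_invSelf, map_one]
  let g : blowupAlgebra (Ideal.span (Set.range x)) (x i) →+* K :=
    Θ.comp (blowupAlgebra (Ideal.span (Set.range x)) (x i)).val.toRingHom
  have hgalg : ∀ s : S, g (algebraMap S (blowupAlgebra (Ideal.span (Set.range x)) (x i)) s) = (s : K) :=
    fun s => hΘalg s
  have hgfrac : ∀ j : Fin d, g (blowupAlgebra.frac x i j) = ((x j : S) : K) / ((x i : S) : K) := by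
    intro j
    change Θ ((blowupAlgebra.frac x i j : Localization.Away (x i))) = _
    rw [blowupAlgebra.coe_frac, map_mul, hΘalg, hΘinv, div_eq_mul_inv]
  -- `g ∘ eval = eval₂ (x_j/x_i)`
  have hgeval : g.comp (blowupAlgebra.eval x i).toRingHom =
      MvPolynomial.eval₂Hom S.subtype
        (fun j : {j : Fin d // j ≠ i} => ((x j.1 : S) : K) / ((x i : S) : K)) := by
    refine (blowupAlgebra.comp_val_comp_eval x i Θ).trans ?_
    congr 1
    · ext s
      exact hΘalg s
    · funext j
      exact hgfrac j.1
  have hgeval' : ∀ P, g (blowupAlgebra.eval x i P) = MvPolynomial.eval₂Hom S.subtype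
      (fun j : {j : Fin d // j ≠ i} => ((x j.1 : S) : K) / ((x i : S) : K)) P := fun P => by
    rw [← hgeval]; rfl
  -- the range of `g` is `S[𝔪/x_i] ⊆ K`
  have heval_mem : ∀ P : MvPolynomial {j : Fin d // j ≠ i} S, MvPolynomial.eval₂Hom S.subtype
      (fun j : {j : Fin d // j ≠ i} => ((x j.1 : S) : K) / ((x i : S) : K)) P ∈
        blowupRing S (x i : K) := by
    intro P
    induction P using MvPolynomial.induction_on with
    | C s =>
      rw [MvPolynomial.eval₂Hom_C]
      exact le_blowupRing S _ s.2
    | add p q hp hq =>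
      rw [map_add]
      exact Subring.add_mem _ hp hq
    | mul_X p j hp =>
      rw [map_mul, MvPolynomial.eval₂Hom_X']
      exact Subring.mul_mem _ hp (div_mem_blowupRing _ (hxm j.1))
  have hrange : g.range = blowupRing S (x i : K) := by
    apply le_antisymm
    · rintro _ ⟨z, rfl⟩
      obtain ⟨P, rfl⟩ := blowupAlgebra.eval_surjective x i z
      rw [hgeval']
      exact heval_mem P
    · rw [blowupRing_eq_closure_of_span_eq ((x i : S) : K) (Set.range x) hx, Subring.closure_le]
      rintro z (hz | ⟨y, ⟨j, rfl⟩, rfl⟩)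
      · exact ⟨algebraMap S _ ⟨z, hz⟩, hgalg ⟨z, hz⟩⟩
      · exact ⟨blowupAlgebra.frac x i j, hgfrac j⟩
  -- `g` is injective
  have hΘinj : ∀ z, Θ z = 0 → z = 0 := by
    intro z hz
    obtain ⟨⟨r, s⟩, hrs⟩ := IsLocalization.surj (Submonoid.powers (x i)) z
    have hr : (r : K) = 0 := by
      have h := congrArg Θ hrs
      rw [map_mul, hz, zero_mul, hΘalg] at h
      exact h.symm
    have hr0 : r = 0 := Subtype.ext hr
    rw [hr0, map_zero] at hrs
    exact (IsUnit.mul_left_eq_zero (IsLocalization.map_units _ s)).mp hrs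
  have hginj : Function.Injective g := by
    intro a b h
    apply Subtype.ext
    have h0 : Θ ((a : Localization.Away (x i)) - b) = 0 := by
      rw [map_sub]
      exact sub_eq_zero.mpr h
    exact sub_eq_zero.mp (hΘinj _ h0)
  -- `e₁ : S[𝔪/x_i] ≃ blowupRing S x_i`
  have hmem : ∀ b, g b ∈ blowupRing S (x i : K) := fun b => by rw [← hrange]; exact ⟨b, rfl⟩
  let g' : blowupAlgebra (Ideal.span (Set.range x)) (x i) →+* blowupRing S (x i : K) :=
    g.codRestrict _ hmem
  have hg' : Function.Bijective g' := by
    refine ⟨fun a b h => hginj (congrArg Subtype.val h), fun z => ?_⟩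
    have hz : (z : K) ∈ g.range := by rw [hrange]; exact z.2
    obtain ⟨b, hb⟩ := hz
    exact ⟨b, Subtype.ext hb⟩
  let e₁ : blowupAlgebra (Ideal.span (Set.range x)) (x i) ≃+* blowupRing S (x i : K) :=
    RingEquiv.ofBijective g' hg'
  have he₁alg : ∀ s : S, e₁ (algebraMap S (blowupAlgebra (Ideal.span (Set.range x)) (x i)) s) =
      ⟨(s : K), le_blowupRing S (x i : K) s.2⟩ :=
    fun s => Subtype.ext (hgalg s)
  -- the presentation modulo `x_i`: `S[T] → S[𝔪/x_i]/(x_i)` is onto with kernel `𝔪 · S[T]`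
  let J : Ideal (blowupAlgebra (Ideal.span (Set.range x)) (x i)) :=
    Ideal.span {algebraMap S (blowupAlgebra (Ideal.span (Set.range x)) (x i)) (x i)}
  let π : MvPolynomial {j : Fin d // j ≠ i} S →+* blowupAlgebra (Ideal.span (Set.range x)) (x i) ⧸ J :=
    (Ideal.Quotient.mk J).comp (blowupAlgebra.eval x i).toRingHom
  have hπsurj : Function.Surjective π :=
    Ideal.Quotient.mk_surjective.comp (blowupAlgebra.eval_surjective x i)
  have hπker : RingHom.ker π = Ideal.map MvPolynomial.C (Ideal.span (Set.range x)) := by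
    change RingHom.ker ((Ideal.Quotient.mk J).comp _) = _
    rw [← RingHom.comap_ker, Ideal.mk_ker]
    exact blowupAlgebra.comap_eval_span_algebraMap_eq x i
      (isQuasiRegular_regularSystemOfParameters hd x hx)
  -- `S[T] → κ(S)[T]` is onto with the same kernel
  let σ : MvPolynomial {j : Fin d // j ≠ i} S →+* MvPolynomial {j : Fin d // j ≠ i} (ResidueField S) :=
    MvPolynomial.map (residue S)
  have hσsurj : Function.Surjective σ := MvPolynomial.map_surjective _ residue_surjective
  have hσker : RingHom.ker σ = Ideal.map MvPolynomial.C (Ideal.span (Set.range x)) := by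
    change RingHom.ker (MvPolynomial.map (residue S)) = _
    rw [MvPolynomial.ker_map, ker_residue, hx]
  -- hence `ψ' : κ(S)[T] → S[𝔪/x_i]/(x_i)`, a bijection
  let ψ' : MvPolynomial {j : Fin d // j ≠ i} (ResidueField S) →+*
      blowupAlgebra (Ideal.span (Set.range x)) (x i) ⧸ J :=
    σ.liftOfSurjective hσsurj ⟨π, by rw [hσker, hπker]⟩
  have hψ'σ : ∀ P, ψ' (σ P) = π P := fun P =>
    σ.liftOfSurjective_comp_apply hσsurj ⟨π, by rw [hσker, hπker]⟩ P
  have hψ'bij : Function.Bijective ψ' := by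
    constructor
    · refine (injective_iff_map_eq_zero ψ').mpr fun Q hQ => ?_
      obtain ⟨P, rfl⟩ := hσsurj Q
      rw [hψ'σ] at hQ
      have hP : P ∈ RingHom.ker σ := by rw [hσker, ← hπker]; exact hQ
      exact hP
    · intro z
      obtain ⟨P, rfl⟩ := hπsurj z
      exact ⟨σ P, hψ'σ P⟩
  -- transport `S[𝔪/x_i]/(x_i) ≅ blowupRing/(x_i)` along `e₁`
  let J' : Ideal (blowupRing S (x i : K)) :=
    Ideal.span {(⟨(x i : K), le_blowupRing S (x i : K) (x i).2⟩ : blowupRing S (x i : K))}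
  have hJJ' : J' = J.map (e₁ : blowupAlgebra (Ideal.span (Set.range x)) (x i) →+* blowupRing S (x i : K)) := by
    change Ideal.span _ = Ideal.map _ (Ideal.span _)
    rw [Ideal.map_span, Set.image_singleton]
    congr 2
    exact (he₁alg (x i)).symm
  let q : blowupAlgebra (Ideal.span (Set.range x)) (x i) ⧸ J ≃+* blowupRing S (x i : K) ⧸ J' :=
    Ideal.quotientEquiv J J' e₁ hJJ'
  refine ⟨q.toRingHom.comp ψ', q.bijective.comp hψ'bij, fun s => ?_⟩
  -- constants: `C s̄ ↦ [s/1] ↦ [s]`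
  have hσC : σ (MvPolynomial.C s) = MvPolynomial.C (residue S s) := MvPolynomial.map_C _ _
  change q (ψ' (MvPolynomial.C (residue S s))) = _
  rw [← hσC, hψ'σ]
  change q (Ideal.Quotient.mk J ((blowupAlgebra.eval x i) (MvPolynomial.C s))) = _
  rw [blowupAlgebra.eval_C, Ideal.quotientEquiv_mk]
  congr 1
  exact he₁alg s

/-- **`S[𝔪/x_i]/(x_i)` is a regular ring** for a regular system of parameters `x` of the regular local
subring `S ⊆ K` and `x_i ≠ 0`: it is a polynomial ring over the residue field (`blowupRing_chartQuotient`;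
Mathlib `MvPolynomial.isRegularRing_of_isRegularRing`). [cite: StacksProject, Tag 0BIQ] -/
theorem isRegularRing_blowupRing_quotient_of_rsop (S : Subring K) [IsRegularLocalRing S] {d : ℕ}
    (hd : (maximalIdeal S).spanFinrank = d) (x : Fin d → S)
    (hx : Ideal.span (Set.range x) = maximalIdeal S) (i : Fin d) (hxi : x i ≠ 0) :
    IsRegularRing (blowupRing S (x i : K) ⧸
      Ideal.span {(⟨(x i : K), le_blowupRing S (x i : K) (x i).2⟩ : blowupRing S (x i : K))}) := by
  obtain ⟨ψ, hψ, -⟩ := blowupRing_chartQuotient S hd x hx i hxi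
  exact IsRegularRing.of_ringEquiv (RingEquiv.ofBijective ψ hψ)

/-- **The exceptional prime of the chart**: for a regular system of parameters `x` of the regular local
subring `S ⊆ K` and `x_i ≠ 0`, the principal ideal `(x_i) ⊂ S[𝔪/x_i]` is prime — the quotient is the
domain `κ(S)[T_j : j ≠ i]` (`blowupRing_chartQuotient`). [cite: StacksProject, Tag 0BIQ] -/
theorem isPrime_span_singleton_blowupRing_of_rsop (S : Subring K) [IsRegularLocalRing S] {d : ℕ}
    (hd : (maximalIdeal S).spanFinrank = d) (x : Fin d → S)
    (hx : Ideal.span (Set.range x) = maximalIdeal S) (i : Fin d) (hxi : x i ≠ 0) :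
    (Ideal.span {(⟨(x i : K), le_blowupRing S (x i : K) (x i).2⟩ :
      blowupRing S (x i : K))}).IsPrime := by
  obtain ⟨ψ, hψ, -⟩ := blowupRing_chartQuotient S hd x hx i hxi
  rw [← Ideal.Quotient.isDomain_iff_prime]
  exact MulEquiv.isDomain _ (RingEquiv.ofBijective ψ hψ).symm.toMulEquiv

end Exceptional

/-! ## A regular system of parameters through a given element of `𝔪 ∖ 𝔪²` -/

/-- In a regular local ring of embedding dimension `d`, an element `x ∈ 𝔪 ∖ 𝔪²` is the `j`-th member
of some regular system of parameters, for any prescribed `j : Fin d` (Matsumura Thm. 14.2: `R/(x)` is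
regular of dimension `d - 1`, so `x` is part of a minimal basis of `𝔪` — `IsRsopPart`; then permute).
[cite: Matsumura1987, Thm. 14.2] -/
theorem exists_rsop_apply_eq {R : Type u} [CommRing R] [IsRegularLocalRing R] {d : ℕ}
    (hd : (maximalIdeal R).spanFinrank = d) {x : R} (hx : x ∈ maximalIdeal R)
    (hx2 : x ∉ maximalIdeal R ^ 2) (j : Fin d) :
    ∃ z : Fin d → R, Ideal.span (Set.range z) = maximalIdeal R ∧ z j = x := by
  -- adapted from Summits/…/Theorems/FrobeniusClosingSteerCore4IsoChartZero.lean (`exists_rsop_apply_eq`)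
  classical
  obtain ⟨hq, hdim⟩ := IsRegularLocalRing.quotient_span_singleton hx hx2
  let z₁ : Fin 1 → R := fun _ => x
  have hr : Set.range z₁ = {x} := Set.range_const
  have hq' : IsRegularLocalRing (R ⧸ Ideal.span (Set.range z₁)) := by rw [hr]; exact hq
  have hdim' : ringKrullDim (R ⧸ Ideal.span (Set.range z₁)) + (1 : ℕ) ≤ ringKrullDim R := by
    rw [hr, Nat.cast_one]
    exact hdim.le
  have hpart : IsRsopPart z₁ :=
    IsRsopPart.of_isRegularLocalRing_quotient (fun _ => hx) (hq := hq') hdim'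
  obtain ⟨e, w, hsf, hspan, hw⟩ := hpart.exists_rsop
  have hde : d = 1 + e := hd.symm.trans hsf
  let σ : Fin d ≃ Fin (1 + e) := finCongr hde
  let i₀ : Fin (1 + e) := Fin.castAdd e 0
  let τ : Fin d ≃ Fin (1 + e) := σ.trans (Equiv.swap (σ j) i₀)
  refine ⟨w ∘ τ, ?_, ?_⟩
  · rw [τ.surjective.range_comp]
    exact hspan
  · change w (Equiv.swap (σ j) i₀ (σ j)) = x
    rw [Equiv.swap_apply_left]
    exact hw 0

/-! ## The same for a single `x ∈ 𝔪_S ∖ 𝔪_S²` -/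
section Single

variable {K : Type u} [Field K]

/-- A Noetherian local subring of a field with a nonzero element in `𝔪` has `emb dim > 0`. [folklore] -/
private theorem spanFinrank_maximalIdeal_ne_zero (S : Subring K) [IsLocalRing S]
    [IsNoetherianRing S] {x : K} (hxS : x ∈ S) (hxm : (⟨x, hxS⟩ : S) ∈ maximalIdeal S)
    (hx0 : x ≠ 0) : (maximalIdeal S).spanFinrank ≠ 0 := by
  intro h0
  have hgen := (IsNoetherian.noetherian (maximalIdeal S)).generators_ncard
  rw [h0, Set.ncard_eq_zero (Submodule.FG.finite_generators (IsNoetherian.noetherian _))] at hgen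
  have hspan := Submodule.span_generators (maximalIdeal S : Submodule S S)
  rw [hgen, Submodule.span_empty] at hspan
  have hxbot : (⟨x, hxS⟩ : S) ∈ (⊥ : Ideal S) := hspan ▸ hxm
  exact hx0 (congrArg Subtype.val ((Submodule.mem_bot S).mp hxbot))

/-- **The exceptional fibre of the `x`-chart is an affine space**, for a single `x ∈ 𝔪_S ∖ 𝔪_S²` of
the regular local subring `S ⊆ K` of embedding dimension `d`: `S[𝔪/x]/(x) ≅ κ(S)[T_j : j ≠ 0]`
compatibly with `S → S[𝔪/x]` (`exists_rsop_apply_eq` + `blowupRing_chartQuotient`).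
[cite: StacksProject, Tag 0BIQ] -/
theorem blowupRing_chartQuotient_of_not_mem_sq (S : Subring K) [IsRegularLocalRing S] {d : ℕ}
    (hd : (maximalIdeal S).spanFinrank = d) {x : K} (hxS : x ∈ S)
    (hxm : (⟨x, hxS⟩ : S) ∈ maximalIdeal S) (hx2 : (⟨x, hxS⟩ : S) ∉ maximalIdeal S ^ 2)
    (hx0 : x ≠ 0) (hd0 : 0 < d) :
    ∃ ψ : MvPolynomial {j : Fin d // j ≠ ⟨0, hd0⟩} (ResidueField S) →+*
        blowupRing S x ⧸ Ideal.span {(⟨x, le_blowupRing S x hxS⟩ : blowupRing S x)},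
      Function.Bijective ψ ∧
      ∀ s : S, ψ (MvPolynomial.C (residue S s)) =
        Ideal.Quotient.mk _ ⟨(s : K), le_blowupRing S x s.2⟩ := by
  classical
  obtain ⟨z, hz, hzj⟩ := exists_rsop_apply_eq hd hxm hx2 ⟨0, hd0⟩
  have hzi : z ⟨0, hd0⟩ ≠ 0 := by
    rw [hzj]
    exact fun h => hx0 (congrArg Subtype.val h)
  -- transport along `z 0 = x`
  have hco : ((z ⟨0, hd0⟩ : S) : K) = x := by rw [hzj]
  subst hco
  exact blowupRing_chartQuotient S hd z hz ⟨0, hd0⟩ hzi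

/-- **`S[𝔪/x]/(x)` is a regular ring** for the regular local subring `S ⊆ K` and `x ∈ 𝔪_S ∖ 𝔪_S²`
(verbatim the statement of `SwitchingDichotomy.DivisorTrigger.isRegularRing_blowupRing_quotient` of
`Theorems/FrobeniusClosingSteerDivisorTriggerTwoChart.lean`): a polynomial ring over `κ(S)`
(`blowupRing_chartQuotient_of_not_mem_sq`). [cite: StacksProject, Tag 0BIQ] -/
theorem isRegularRing_blowupRing_quotient (S : Subring K) [IsRegularLocalRing S] {x : K} (hxS : x ∈ S)
    (hxm : (⟨x, hxS⟩ : S) ∈ maximalIdeal S) (hx2 : (⟨x, hxS⟩ : S) ∉ maximalIdeal S ^ 2)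
    (hx0 : x ≠ 0) :
    IsRegularRing (blowupRing S x ⧸ Ideal.span {(⟨x, le_blowupRing S x hxS⟩ : blowupRing S x)}) := by
  have hd0 : 0 < (maximalIdeal S).spanFinrank :=
    Nat.pos_of_ne_zero (spanFinrank_maximalIdeal_ne_zero S hxS hxm hx0)
  obtain ⟨ψ, hψ, -⟩ := blowupRing_chartQuotient_of_not_mem_sq S rfl hxS hxm hx2 hx0 hd0
  exact IsRegularRing.of_ringEquiv (RingEquiv.ofBijective ψ hψ)

/-- **The exceptional prime `(x) ⊂ S[𝔪/x]`** for the regular local subring `S ⊆ K` and `x ∈ 𝔪_S ∖ 𝔪_S²`: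
the principal ideal `(x)` of the chart ring is prime (quotient `≅ κ(S)[T]`). [cite: StacksProject, Tag 0BIQ] -/
theorem isPrime_span_singleton_blowupRing (S : Subring K) [IsRegularLocalRing S] {x : K}
    (hxS : x ∈ S) (hxm : (⟨x, hxS⟩ : S) ∈ maximalIdeal S)
    (hx2 : (⟨x, hxS⟩ : S) ∉ maximalIdeal S ^ 2) (hx0 : x ≠ 0) :
    (Ideal.span {(⟨x, le_blowupRing S x hxS⟩ : blowupRing S x)}).IsPrime := by
  have hd0 : 0 < (maximalIdeal S).spanFinrank :=
    Nat.pos_of_ne_zero (spanFinrank_maximalIdeal_ne_zero S hxS hxm hx0)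
  obtain ⟨ψ, hψ, -⟩ := blowupRing_chartQuotient_of_not_mem_sq S rfl hxS hxm hx2 hx0 hd0
  rw [← Ideal.Quotient.isDomain_iff_prime]
  exact MulEquiv.isDomain _ (RingEquiv.ofBijective ψ hψ).symm.toMulEquiv

/-- **`S[𝔪/x]/(x)` is an integral domain** for the regular local subring `S ⊆ K` and `x ∈ 𝔪_S ∖ 𝔪_S²`
(the class form of `isPrime_span_singleton_blowupRing`). [cite: StacksProject, Tag 0BIQ] -/
theorem isDomain_blowupRing_quotient (S : Subring K) [IsRegularLocalRing S] {x : K} (hxS : x ∈ S)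
    (hxm : (⟨x, hxS⟩ : S) ∈ maximalIdeal S) (hx2 : (⟨x, hxS⟩ : S) ∉ maximalIdeal S ^ 2)
    (hx0 : x ≠ 0) :
    IsDomain (blowupRing S x ⧸ Ideal.span {(⟨x, le_blowupRing S x hxS⟩ : blowupRing S x)}) :=
  (Ideal.Quotient.isDomain_iff_prime _).mpr (isPrime_span_singleton_blowupRing S hxS hxm hx2 hx0)

end Single

end Literature.AlgebraicGeometry.Resolution

end
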